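import Summits.NavierStokesRegularity.OSWSelfSimilar.SheetRLinearisedSemigroupEven
import Summits.NavierStokesRegularity.OSWSelfSimilar.SheetRLinearisedRenewal
import HarnessLib

/-!
# SHEET-ℝ frame, renewal route (R-a)/(R-d) on the EVEN ZERO-MASS class: the even linearised flow `e^{τ(T⁺ + θℓ(·)f)}` obeys a scalar RENEWAL EQUATION whose
# kernel `k(τ) = θℓ(S⁺(τ)f)` has Laplace transform `1 − E⁺(σ)`, `E⁺` = the even Evans function of record

HONEST FRAMING (cell ns-blowup GROUP B / zone Z3, case Z3-SR-SPEC EVEN half, P-list items (P9)⁺ / (P10)⁺ — the even twin of selfsim g13's `SheetRLinearisedRenewal`;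
1-D MODEL certificate frame (viscous gCLM/OSW sheet on the line); not Euler/NS; «violates: none — MODEL»).  Nothing here asserts that a profile or an eigenvalue exists:
the (S1⁺) Gårding datum (interval arithmetic) is the HYPOTHESIS `GardingDataKE`; `ℓ`, `f`, `θ` are ARBITRARY (dictionary: `−DG⁺(Ω*)|E⁺₀ = T⁺ + θℓ(·)f`,
`T⁺ = generatorEven`, `E⁺ = evansEven hL K h ℓ f θ`).

For ANY pair of C₀-semigroups `S`, `S_F` on `WcevenZ hL` with the generator data delivered by `SheetRLinearisedSemigroupEven.exists_c0SemigroupE`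
(`S.generator = T⁺`, Laplace transform `= resolventEven`, `‖S(τ)‖ ≤ e^{−mτ}`) and `….exists_c0Semigroup_fullE` (`D(S_F.generator) = D(T⁺)`,
`S_F.generator u = T⁺u + θℓ(u)f`) this file proves:
* **`renewal_equation_sheetE`** — with `m(t) := θℓ(S_F(t)δ₀)`, `m₀(t) := θℓ(S(t)δ₀)`, `k(τ) := θℓ(S(τ)f)`: `m(t) = m₀(t) + ∫₀ᵗ k(t − s) m(s) ds`, the reconstruction
  `S_F(t)δ₀ = S(t)δ₀ + ∫₀ᵗ m(s)·S(t − s)f ds` (`flow_eq_add_integral_sheetE`) and the bounds `|k(τ)| ≤ ‖θ‖‖ℓ‖‖f‖e^{−mτ}`, `|m₀(t)| ≤ ‖θ‖‖ℓ‖‖δ₀‖e^{−mt}`;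
* **`laplace_kernel_eq_one_sub_evansEven`** — THE (R-d) DICTIONARY on `E⁺₀`: `∫₀^∞ e^{−στ}k(τ) dτ = θℓ(R⁺_K(σ)f) = 1 − E⁺(σ)` for every `Re σ > −m`; so the symbol
  `1 − k̂` of the even renewal equation IS the even Evans function, whose zero set in `{Re σ ≥ −3/100}` the S2⁺ word pins to the simple zero `σ = 1/2`
  (translation mode).
Generic inputs: `Literature/Analysis/UnboundedOperators/RankOneDuhamelRenewal` (`C0Semigroup.renewal_equation`, `app_eq_add_integral_rankOne`, `norm_kernel_le`,
`integrableOn_integrand`).  No definition, no named fact.  WHAT THIS IS NOT: not NS; not (R-c) and not the even stability word (needs the even spectral sentence (D));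
no number of record moves.
-/

noncomputable section

namespace Summit.NavierStokesRegularity.OSWSelfSimilar
namespace SheetRLinearisedRenewalEven

open _root_.MeasureTheory _root_.Set _root_.Filter SheetREnergySpace SheetRComplexPivot SheetREvenEnergySpace SheetREvenForms SheetREvenClass
  SheetRResolventEvenClass SheetRGeneratorEvenWeak SheetREvansEven SheetRLinearisedSemigroup SheetRLinearisedSemigroupEven
  Literature.Analysis.OperatorTheory Literature.Analysis.UnboundedOperators
open scoped Topology NNReal

variable {L D₀ D₁ V₀ c m : ℝ} {d V : ℝ → ℝ}

/-! ### §1 From the generator data to the hypotheses of the generic renewal theorem -/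

/-- The generator of `S_F` differs from that of `S` by the rank-one operator `(θ•ℓ)(·)f` on the common domain — the hypotheses `hdom`/`hgen` of
`C0Semigroup.renewal_equation`, read off the conclusions of `exists_c0SemigroupE` / `exists_c0Semigroup_fullE`. [folklore] -/
theorem generator_dataE (hL : 0 < L) (K : EspE L hL →L[ℝ] W L) (h : GardingDataKE L hL d V K D₀ D₁ V₀ c m) {σ₀ : ℂ} (hσ₀ : -m < σ₀.re)
    (ℓ : WcevenZ hL →L[ℂ] ℂ) (f : WcevenZ hL) (θ : ℂ) (S SF : C0Semigroup ℂ (WcevenZ hL)) (hS : S.generator = generatorEven hL K h σ₀ hσ₀)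
    (hdomF : (SF.generator.domain : Set (WcevenZ hL)) = (generatorEven hL K h σ₀ hσ₀).domain)
    (hgenF : ∀ (u : WcevenZ hL) (hu : u ∈ (generatorEven hL K h σ₀ hσ₀).domain), ∃ hu' : u ∈ SF.generator.domain,
      SF.generator ⟨u, hu'⟩ = generatorEven hL K h σ₀ hσ₀ ⟨u, hu⟩ + (θ * ℓ u) • f) :
    (∀ u : WcevenZ hL, u ∈ SF.generator.domain ↔ u ∈ S.generator.domain) ∧
      ∀ (u : WcevenZ hL) (hSF : u ∈ SF.generator.domain) (hS' : u ∈ S.generator.domain),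
        SF.generator ⟨u, hSF⟩ = S.generator ⟨u, hS'⟩ + (θ • ℓ) u • f := by
  have hdom : ∀ u : WcevenZ hL, u ∈ SF.generator.domain ↔ u ∈ S.generator.domain := by
    intro u
    rw [hS, ← SetLike.mem_coe, hdomF, SetLike.mem_coe]
  refine ⟨hdom, fun u hSF hS' => ?_⟩
  have huT : u ∈ (generatorEven hL K h σ₀ hσ₀).domain := by rw [← hS]; exact hS'
  obtain ⟨hu', hB⟩ := hgenF u huT
  have hTS : generatorEven hL K h σ₀ hσ₀ ⟨u, huT⟩ = S.generator ⟨u, hS'⟩ := by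
    have hgr : ((u : WcevenZ hL), S.generator ⟨u, hS'⟩) ∈ (generatorEven hL K h σ₀ hσ₀).graph := by
      rw [← hS]; exact S.generator.mem_graph ⟨u, hS'⟩
    exact (generatorEven hL K h σ₀ hσ₀).mem_graph_snd_inj (LinearPMap.mem_graph _ ⟨u, huT⟩) hgr rfl
  have heq : (⟨u, hSF⟩ : SF.generator.domain) = ⟨u, hu'⟩ := rfl
  rw [heq, hB, hTS, smul_apply, smul_eq_mul]

/-! ### §2 The renewal equation of the linearised flow -/

/-- **THE RENEWAL EQUATION ON THE EVEN SHEET CLASS ((R-a) instantiated).**  `m(t) = θℓ(S_F(t)δ₀)` satisfies `m(t) = θℓ(S(t)δ₀) + ∫₀ᵗ θℓ(S(t − s)f)·m(s) ds`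
for every `δ₀` and `t ≥ 0`. 1-D MODEL; the semigroups are hypotheses-by-generator (they exist under (S1) alone by the two (P9) files); NOT NS.
[cite: EngelNagel2000, Ch. III Cor. 1.7] -/
theorem renewal_equation_sheetE (hL : 0 < L) (K : EspE L hL →L[ℝ] W L) (h : GardingDataKE L hL d V K D₀ D₁ V₀ c m) {σ₀ : ℂ} (hσ₀ : -m < σ₀.re)
    (ℓ : WcevenZ hL →L[ℂ] ℂ) (f : WcevenZ hL) (θ : ℂ) (S SF : C0Semigroup ℂ (WcevenZ hL)) (hS : S.generator = generatorEven hL K h σ₀ hσ₀)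
    (hdomF : (SF.generator.domain : Set (WcevenZ hL)) = (generatorEven hL K h σ₀ hσ₀).domain)
    (hgenF : ∀ (u : WcevenZ hL) (hu : u ∈ (generatorEven hL K h σ₀ hσ₀).domain), ∃ hu' : u ∈ SF.generator.domain,
      SF.generator ⟨u, hu'⟩ = generatorEven hL K h σ₀ hσ₀ ⟨u, hu⟩ + (θ * ℓ u) • f)
    (δ₀ : WcevenZ hL) {t : ℝ} (ht : 0 ≤ t) :
    θ * ℓ (SF.app t.toNNReal δ₀) = θ * ℓ (S.app t.toNNReal δ₀)
      + ∫ s in (0 : ℝ)..t, (θ * ℓ (S.app (t - s).toNNReal f)) * (θ * ℓ (SF.app s.toNNReal δ₀)) := by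
  haveI : CompleteSpace (WcevenZ hL) := completeSpace_WcevenZ hL
  obtain ⟨hdom, hgen⟩ := generator_dataE hL K h hσ₀ ℓ f θ S SF hS hdomF hgenF
  have key := C0Semigroup.renewal_equation SF S (θ • ℓ) f hdom hgen δ₀ ht
  simpa only [smul_apply, smul_eq_mul] using key

/-- **Reconstruction of the flow from the gauge coordinate**: `S_F(t)δ₀ = S(t)δ₀ + ∫₀ᵗ m(s)·S(t − s)f ds`, `m(s) = θℓ(S_F(s)δ₀)`.
[cite: EngelNagel2000, Ch. III Cor. 1.7] -/
theorem flow_eq_add_integral_sheetE (hL : 0 < L) (K : EspE L hL →L[ℝ] W L) (h : GardingDataKE L hL d V K D₀ D₁ V₀ c m) {σ₀ : ℂ} (hσ₀ : -m < σ₀.re)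
    (ℓ : WcevenZ hL →L[ℂ] ℂ) (f : WcevenZ hL) (θ : ℂ) (S SF : C0Semigroup ℂ (WcevenZ hL)) (hS : S.generator = generatorEven hL K h σ₀ hσ₀)
    (hdomF : (SF.generator.domain : Set (WcevenZ hL)) = (generatorEven hL K h σ₀ hσ₀).domain)
    (hgenF : ∀ (u : WcevenZ hL) (hu : u ∈ (generatorEven hL K h σ₀ hσ₀).domain), ∃ hu' : u ∈ SF.generator.domain,
      SF.generator ⟨u, hu'⟩ = generatorEven hL K h σ₀ hσ₀ ⟨u, hu⟩ + (θ * ℓ u) • f)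
    (δ₀ : WcevenZ hL) {t : ℝ} (ht : 0 ≤ t) :
    SF.app t.toNNReal δ₀ = S.app t.toNNReal δ₀ + ∫ s in (0 : ℝ)..t, (θ * ℓ (SF.app s.toNNReal δ₀)) • S.app (t - s).toNNReal f := by
  haveI : CompleteSpace (WcevenZ hL) := completeSpace_WcevenZ hL
  obtain ⟨hdom, hgen⟩ := generator_dataE hL K h hσ₀ ℓ f θ S SF hS hdomF hgenF
  have key := C0Semigroup.app_eq_add_integral_rankOne SF S (θ • ℓ) f hdom hgen δ₀ ht
  simpa only [smul_apply, smul_eq_mul] using key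

/-- **Kernel bound**: `|k(τ)| = |θℓ(S(τ)f)| ≤ ‖θ‖‖ℓ‖‖f‖·e^{−mτ}` from `‖S(τ)‖ ≤ e^{−mτ}`. [cite: EngelNagel2000, Ch. III Cor. 1.7] -/
theorem norm_kernel_le_sheetE {hL : 0 < L} (ℓ : WcevenZ hL →L[ℂ] ℂ) (f : WcevenZ hL) (θ : ℂ) (S : C0Semigroup ℂ (WcevenZ hL))
    (hM : ∀ τ : ℝ≥0, ‖S.app τ‖ ≤ Real.exp (-m * τ)) (τ : ℝ≥0) :
    ‖θ * ℓ (S.app τ f)‖ ≤ ‖θ‖ * ‖ℓ‖ * ‖f‖ * Real.exp (-m * τ) := by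
  have hM' : ∀ t : ℝ≥0, ‖S.app t‖ ≤ 1 * Real.exp (-m * t) := fun t => by rw [one_mul]; exact hM t
  have h := C0Semigroup.norm_kernel_le S hM' (θ • ℓ) f τ
  rw [smul_apply, smul_eq_mul] at h
  calc ‖θ * ℓ (S.app τ f)‖ ≤ ‖θ • ℓ‖ * (1 * Real.exp (-m * τ)) * ‖f‖ := h
    _ ≤ ‖θ‖ * ‖ℓ‖ * (1 * Real.exp (-m * τ)) * ‖f‖ := by
        gcongr; exact ContinuousLinearMap.opNorm_smul_le θ ℓ
    _ = ‖θ‖ * ‖ℓ‖ * ‖f‖ * Real.exp (-m * τ) := by ring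

/-- **Forcing bound**: `|m₀(t)| = |θℓ(S(t)δ₀)| ≤ ‖θ‖‖ℓ‖‖δ₀‖·e^{−mt}`. [cite: EngelNagel2000, Ch. III Cor. 1.7] -/
theorem norm_forcing_le_sheetE {hL : 0 < L} (ℓ : WcevenZ hL →L[ℂ] ℂ) (θ : ℂ) (S : C0Semigroup ℂ (WcevenZ hL))
    (hM : ∀ τ : ℝ≥0, ‖S.app τ‖ ≤ Real.exp (-m * τ)) (δ₀ : WcevenZ hL) (t : ℝ≥0) :
    ‖θ * ℓ (S.app t δ₀)‖ ≤ ‖θ‖ * ‖ℓ‖ * ‖δ₀‖ * Real.exp (-m * t) :=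
  norm_kernel_le_sheetE ℓ δ₀ θ S hM t

/-! ### §3 The Laplace transform of the kernel is `1 − E` -/

/-- `θℓ(∫₀^∞ e^{−στ}S(τ)f dτ) = 1 − E(σ)`: the Laplace bridge `laplaceResolventFun S σ = resolventEven σ` makes `θℓ(R_K(σ)f)` appear, which is
`1 − evansEven σ` by definition. [folklore] -/
theorem mul_apply_laplace_eqE (hL : 0 < L) (K : EspE L hL →L[ℝ] W L) (h : GardingDataKE L hL d V K D₀ D₁ V₀ c m)
    (ℓ : WcevenZ hL →L[ℂ] ℂ) (f : WcevenZ hL) (θ : ℂ) (S : C0Semigroup ℂ (WcevenZ hL))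
    (hlap : ∀ σ : ℂ, -m < σ.re → ∀ G : WcevenZ hL, S.laplaceResolventFun σ G = resolventEven hL K h σ G) {σ : ℂ} (hσ : -m < σ.re) :
    θ * ℓ (S.laplaceResolventFun σ f) = 1 - evansEven hL K h ℓ f θ σ := by
  rw [hlap σ hσ f, evansEven]
  ring

/-- **THE (R-d) DICTIONARY: the Laplace transform of the renewal kernel is `1 − E`.**  For `S` with `‖S(τ)‖ ≤ e^{−mτ}` and Laplace transform
`resolventEven` (the coercive semigroup of `SheetRLinearisedSemigroupEven.exists_c0SemigroupE`), and every `σ` with `Re σ > −m`: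
`∫₀^∞ e^{−στ}·θℓ(S(τ)f) dτ = 1 − evansEven hL K h ℓ f θ σ`.  Hence the symbol `1 − k̂(σ)` of the renewal equation `renewal_equation_sheetE` IS the Evans
function of record, whose zeros in `{Re σ > −3/100}` the S2 certificate pins to the simple zero `σ = 1/2`. 1-D MODEL; NOT NS; no inversion is done here.
[folklore] -/
theorem laplace_kernel_eq_one_sub_evansEven (hL : 0 < L) (K : EspE L hL →L[ℝ] W L) (h : GardingDataKE L hL d V K D₀ D₁ V₀ c m)
    (ℓ : WcevenZ hL →L[ℂ] ℂ) (f : WcevenZ hL) (θ : ℂ) (S : C0Semigroup ℂ (WcevenZ hL)) (hM : ∀ τ : ℝ≥0, ‖S.app τ‖ ≤ Real.exp (-m * τ))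
    (hlap : ∀ σ : ℂ, -m < σ.re → ∀ G : WcevenZ hL, S.laplaceResolventFun σ G = resolventEven hL K h σ G) {σ : ℂ} (hσ : -m < σ.re) :
    ∫ τ in Ioi (0 : ℝ), Complex.exp (-(σ * τ)) * (θ * ℓ (S.app (Real.toNNReal τ) f)) = 1 - evansEven hL K h ℓ f θ σ := by
  haveI : CompleteSpace (WcevenZ hL) := completeSpace_WcevenZ hL
  have hM' : ∀ t : ℝ≥0, ‖S.app t‖ ≤ 1 * Real.exp (-m * t) := fun t => by rw [one_mul]; exact hM t
  have hint := C0Semigroup.integrableOn_integrand S hM' (l := σ) (by linarith) f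
  -- `θℓ` commutes with the Bochner integral over `(0, ∞)`
  have hcomm := ((θ • ℓ).integral_comp_comm hint)
  -- rewrite the integrand `(θℓ)(e^{−στ} • S(τ)f) = e^{−στ}·θℓ(S(τ)f)`
  have hcongr : (fun τ : ℝ => (θ • ℓ) (Complex.exp (-(σ * τ)) • S.app (Real.toNNReal τ) f)) =
      fun τ : ℝ => Complex.exp (-(σ * τ)) * (θ * ℓ (S.app (Real.toNNReal τ) f)) := by
    funext τ
    rw [map_smul, smul_apply, smul_eq_mul, smul_eq_mul]
  rw [hcongr] at hcomm
  have hdef : (∫ τ in Ioi (0 : ℝ), Complex.exp (-(σ * τ)) • S.app (Real.toNNReal τ) f) = S.laplaceResolventFun σ f := rfl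
  rw [hcomm, smul_apply, smul_eq_mul, hdef]
  exact mul_apply_laplace_eqE hL K h ℓ f θ S hlap hσ

end SheetRLinearisedRenewalEven
end Summit.NavierStokesRegularity.OSWSelfSimilar

end
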